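import Summits.NavierStokesRegularity.NavierStokesRegularity.Theses.TautLoopKelvin
import Summits.NavierStokesRegularity.NavierStokesRegularity.Theorems.TautLoopKelvinCirculationFloor
import Summits.NavierStokesRegularity.NavierStokesRegularity.Theorems.TautLoopKelvinTautCompressionIntegrableSummitEquivalence
import Summits.NavierStokesRegularity.NavierStokesRegularity.Theorems.TautLoopKelvinTautCompressionIntegrableStubExtension
import Summits.NavierStokesRegularity.NavierStokesRegularity.Theorems.CirculationFloor.Negative.ClayVacuity
import Summits.NavierStokesRegularity.NavierStokesRegularity.Theorems.CirculationFloor.Negative.LoadBearing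
import Summits.NavierStokesRegularity.NavierStokesRegularity.Theorems.CirculationFloor.Negative.WithoutClassicalFalse
import Summits.NavierStokesRegularity.NavierStokesRegularity.Theorems.TautLoopLaw.Negative.ClassicalClauseLoadBearing
import Summits.NavierStokesRegularity.NavierStokesRegularity.Theorems.TautCompressionIntegrable.Negative.FalseWithoutMomentum

/-!
# Equivalence audit — crux `TautLoopKelvin.TautCompressionIntegrable` (stmt-NavierStokesRegularity-15248, K1)

Strategist scratch file (planner-cstrat-stmt-NavierStokesRegularity-15248-q1-0, suspect = equivalence, 2026-08-17).
Kernel-checks the logical skeleton behind the flag "K1 ↔ S GIVEN the route's other cruxes"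
(`tautCompressionIntegrable_iff_navierStokesRegularity (hLaw) (hFloor)`), AFTER the sibling `CirculationFloor`
(stmt-1538) landed as `circulationFloor_proof` (12:55Z):

* (A1) the Floor is a closed theorem of the tree, standard axioms;
* (A2) so the certificate specialises: K1 ↔ S given `TautLoopLaw` ALONE (the one OPEN sibling);
* (A3) S → K1 is unconditional (K1 is a necessary condition of regularity: a length-valued BKM hypothesis);
* (A4) `closes` specialised: K1 → Law → S;
* (A5) the proved sibling's hypotheses are load-bearing (landed `false_without` lemmas, re-exported by name);
* (A6) the open sibling's hypotheses are load-bearing (landed `false_without` lemmas);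
* (A7) K1's own hypotheses are load-bearing (momentum equation).
Nothing here is proposed to the tree.
-/

namespace CstratAuditK1

open Summit.NavierStokesRegularity.NavierStokesRegularity

/-- (A1) the proved sibling, by name. -/
theorem floor_proved : Theses.TautLoopKelvin.CirculationFloor := Theorems.circulationFloor_proof

/-- (A2) after the Floor landed: K1 ↔ S given the OPEN crux `TautLoopLaw` alone. -/
theorem K1_iff_S_of_law (hLaw : Theses.TautLoopKelvin.TautLoopLaw) :
    Theses.TautLoopKelvin.TautCompressionIntegrable ↔ _root_.NavierStokesRegularity :=
  Theorems.TautCompressionIntegrable.SummitEquivalence.tautCompressionIntegrable_iff_navierStokesRegularity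
    hLaw Theorems.circulationFloor_proof

/-- (A3) S → K1 unconditionally (no sibling used). -/
theorem K1_of_S (hA : _root_.NavierStokesRegularity) : Theses.TautLoopKelvin.TautCompressionIntegrable :=
  Theorems.TautCompressionIntegrable.SummitEquivalence.tautCompressionIntegrable_of_typeILiouvilleThesis
    (Theorems.TautCompressionIntegrable.SummitEquivalence.typeILiouvilleThesis_of_navierStokesRegularity hA)

/-- (A4) the route's deciding theorem with the proved Floor discharged: K1 → Law → S. -/
theorem S_of_K1_of_law (hK1 : Theses.TautLoopKelvin.TautCompressionIntegrable)
    (hLaw : Theses.TautLoopKelvin.TautLoopLaw) : _root_.NavierStokesRegularity :=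
  Theses.TautLoopKelvin.closes hK1 hLaw Theorems.circulationFloor_proof

/-- (A4') hence, given K1, Law → S; and given Law, the remaining open content of the route is exactly K1. -/
theorem law_gives_S_iff_K1 (hLaw : Theses.TautLoopKelvin.TautLoopLaw) :
    (_root_.NavierStokesRegularity ↔ Theses.TautLoopKelvin.TautCompressionIntegrable) :=
  (K1_iff_S_of_law hLaw).symm

/-- (A5) the PROVED sibling uses its hypotheses non-vacuously: without `¬ HasSmoothExtensionPast` it is FALSE
(rest state), without `IsLerayHopfOn` it is FALSE (parasitic drift), without the classical clause it is FALSE —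
landed Negative lemmas, re-checked by name. -/
example := @Theorems.CirculationFloor.Negative.circulationFloor_false_without_noExtension
example := @Theorems.CirculationFloor.Negative.circulationFloor_false_without_LerayHopf
example := @Theorems.CirculationFloor.Negative.circulationFloor_false_without_classical

/-- (A5') and the Floor's hypothesis class is inhabited iff the summit fails (so the Floor is NOT vacuously true
unless Clay (A) holds, which the tree does not know). -/
theorem floor_class_inhabited_iff_not_S :
    (∃ (ν T : ℝ) (u : ℝ → EuclideanSpace ℝ (Fin 3) → EuclideanSpace ℝ (Fin 3)) (p : ℝ → EuclideanSpace ℝ (Fin 3) → ℝ),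
      0 < ν ∧ 0 < T ∧ Literature.Analysis.FluidPDE.IsClassicalNSSolutionOn (Set.Ico 0 T) ν 0 u p ∧
      Literature.Analysis.FluidPDE.IsLerayHopfOn T ν 0 (u 0) u ∧
      Literature.Analysis.FluidPDE.HasRapidSpatialDecay (u 0) ∧
      ¬ Literature.Analysis.FluidPDE.HasSmoothExtensionPast ν 0 u T) ↔ ¬ _root_.NavierStokesRegularity :=
  Theorems.CirculationFloor.Negative.circulationFloor_hypotheses_iff_not_navierStokesRegularity

/-- (A6) the OPEN sibling `TautLoopLaw` uses its hypotheses non-vacuously: false without the classical clause,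
false up to the terminal time (landed Negative lemmas). -/
theorem law_hyps_loadBearing :
    (¬ Theorems.TautLoopLaw.Negative.TautLoopLawWithoutClassical) ∧
    (¬ Theorems.TautLoopLaw.Negative.TautLoopLawUptoT) :=
  ⟨Theorems.TautLoopLaw.Negative.tautLoopLaw_false_without_classical,
    Theorems.TautLoopLaw.Negative.tautLoopLaw_false_upto_terminal_time⟩

/-- (A7) K1 itself: false without the momentum equation (landed Negative lemma, re-checked by name). -/
example := @Theorems.TautCompressionIntegrable.Negative.tautCompressionIntegrable_false_without_momentum

#print axioms floor_proved
#print axioms K1_iff_S_of_law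
#print axioms K1_of_S
#print axioms S_of_K1_of_law
#print axioms floor_class_inhabited_iff_not_S
#print axioms law_hyps_loadBearing

end CstratAuditK1
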